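import Summits.RiemannHypothesis.RiemannHypothesis.Theorems.HandoffCramer
import Summits.RiemannHypothesis.RiemannHypothesis.Theorems.HandoffSemilocalParitySplit
import HarnessLib

/-!
# HANDOFF — the odd two-bump in EVERY semi-local form: cross machinery, narrow-bump transfer, and the `S`-smooth atoms past the top of `S` (rh-explicit, track «HANDOFF», seat prove-2 gen5, ATTEMPT-12, part 1/2)

HONEST FRAMING. Nothing here bears on the truth of RH. This is the semi-local (`Q_S`, `S` any finite set of primes) version of gen2's
odd-sector edge machinery (`HandoffEdgeOdd.lean`, `HandoffCramerBump.lean`, `HandoffEdgeChebyshev.lean`), the input of the RH-free WALL CEILING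
`a*(S) < (log N)/2 + C·(log N)/√N` of part 2/2 (`HandoffWallCeiling.lean`):

* §1 the `S`-smooth atom mass `Σ_{e^{2c′} ≤ n ≤ e^{2b}} Λ_S(n)/√n` of a lag range and the semi-local prime cross bound
  `‖prime_S(k)‖ ≤ 2·(Σ Λ_S(n)/√n)·sup‖k‖` for kernels living on the lag range `2c′ ≤ |y| ≤ 2b` (`norm_weilSemilocalPrimeTerm_le_of_support`);
* §2 the exact odd two-lobe identity `Q_S(f − f(−·)) = 2·Q_S(f) − 2·W_S(f ⋆ (f(−·))~)` and the witness-side bound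
  `Re Q_S(f − f(−·)) ≤ 2·Re Q_S(f) − 2(|f̂(0)|² + |f̂(1)|²) + 2·(4M(c′)(b − c′) + 2·Σ_{e^{2c′}≤n≤e^{2b}} Λ_S(n)/√n)·‖f‖₂²` for a lobe `f ⊆ [c′, b]`
  (the polar part of the cross energy is `|f̂(0)|² + |f̂(1)|²` EXACTLY and enters with a minus sign; prime and archimedean parts in norm);
* §3 a test function of radius `≤ (log 2)/2` centred anywhere has `Q_S(h) = Q(h)` for every `S` (no prime power is visible), so gen2's Cramér bump
  keeps its energy ceiling `(log(1/r) + cramerEnergyConst)·‖f‖₂²` in every `Q_S` (`re_weilSemilocalQuadratic_cramerBump_le`);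
* §4 if every member of `S` is `< N`, the `S`-smooth prime powers `n ≥ N` are HIGHER powers, so
  `Σ_{N ≤ n ≤ e^{2b}} Λ_S(n)/√n ≤ (ψ(X) − θ(X))/√N` for `e^{2b} ≤ X` (Mathlib's `Chebyshev.psi_sub_theta_eq_sum_not_prime`), and `≤ 3` when
  `N ≤ e^{2b} ≤ 2N`, `N ≥ 10⁷` (gen2's explicit Chebyshev bounds).

References: E. Bombieri, Rend. Mat. Acc. Lincei (9) 11 (2000), Thm 2 / Lemma 2 (`Bombieri2000Weil`); A. Connes, C. Consani, Enseign. Math. 69 (2023) 93–148 = arXiv:2106.01715, §2.1.2–§2.1.3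
(`ConnesConsani2023`, the semi-local forms `QW_λ` and their parity splitting).
-/

set_option linter.dupNamespace false

noncomputable section

open Complex Filter Set MeasureTheory Literature.NumberTheory.LFunctions
  Literature.NumberTheory.LFunctions.WeilContinuous
open Summit.RiemannHypothesis.RiemannHypothesis.Theorems.HandoffSemilocalEnergy (weilSemilocalFunctional_const_mul
  weilSemilocalQuadratic_const_mul)
open Summit.RiemannHypothesis.RiemannHypothesis.Theorems.HandoffSemilocalParitySplit (weilSemilocalFunctional_comp_neg
  weilSemilocalQuadratic_comp_neg weilSemilocalQuadratic_add)
open scoped Real Topology ComplexConjugate ContDiff ArithmeticFunction.vonMangoldt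

namespace Summit.RiemannHypothesis.RiemannHypothesis.Theorems.Handoff

variable {f g h : ℝ → ℂ} {S : Finset ℕ} {q q' N : ℕ}

/-! ## §1 The `S`-smooth atoms of a lag range and the semi-local prime cross bound -/

/-- **Semi-local prime cross bound** for a kernel supported in `[2c′, 2b] ∪ [−2b, −2c′]` and bounded by `N` pointwise:
`‖prime_S(k)‖ ≤ 2·(Σ_{e^{2c′} ≤ n ≤ e^{2b}} Λ_S(n)/√n)·N`. [cite: Bombieri2000Weil, Thm 2 (prime side), primes restricted to S; this track, ATTEMPT-12 §2] -/
theorem norm_weilSemilocalPrimeTerm_le_of_support (S : Finset ℕ) {k : ℝ → ℂ} {c' b M : ℝ} (hc' : 0 < c')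
    (hzero : ∀ y : ℝ, |y| < 2 * c' → k y = 0) (hzero' : ∀ y : ℝ, 2 * b < |y| → k y = 0)
    (hbound : ∀ y : ℝ, ‖k y‖ ≤ M) :
    ‖weilSemilocalPrimeTerm S k‖ ≤ 2 * (∑ n ∈ Finset.Icc ⌈Real.exp (2 * c')⌉₊ ⌊Real.exp (2 * b)⌋₊, weilSemilocalCoeff S n) * M := by
  have hM : 0 ≤ M := (norm_nonneg _).trans (hbound 0)
  set s := Finset.Icc ⌈Real.exp (2 * c')⌉₊ ⌊Real.exp (2 * b)⌋₊ with hs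
  have hvan : ∀ n ∉ s, (weilSemilocalCoeff S n : ℂ) * (k (Real.log n) + k (-Real.log n)) = 0 := by
    intro n hn
    rw [hs, Finset.mem_Icc, not_and_or, not_le, not_le] at hn
    have hk : k (Real.log n) = 0 ∧ k (-Real.log n) = 0 := by
      rcases hn with hlt | hgt
      · have hnlt : (n : ℝ) < Real.exp (2 * c') := Nat.lt_ceil.1 hlt
        have hlog : |Real.log n| < 2 * c' := by
          rcases Nat.eq_zero_or_pos n with rfl | hpos
          · simp; linarith
          · have hn0 : (0 : ℝ) < n := by exact_mod_cast hpos
            have h1 : Real.log n < 2 * c' := by rwa [Real.log_lt_iff_lt_exp hn0]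
            have h2 : -(2 * c') < Real.log n := by
              have : (1 : ℝ) ≤ n := by exact_mod_cast hpos
              linarith [Real.log_nonneg this]
            exact abs_lt.2 ⟨h2, h1⟩
        exact ⟨hzero _ hlog, hzero _ (by rwa [abs_neg])⟩
      · have hngt : Real.exp (2 * b) < n := (Nat.floor_lt (Real.exp_pos _).le).1 hgt
        have hn0 : (0 : ℝ) < n := (Real.exp_pos _).trans hngt
        have hlog : 2 * b < Real.log n := by rwa [Real.lt_log_iff_exp_lt hn0]
        have habs : 2 * b < |Real.log n| := hlog.trans_le (le_abs_self _)
        exact ⟨hzero' _ habs, hzero' _ (by rwa [abs_neg])⟩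
    rw [hk.1, hk.2, add_zero, mul_zero]
  unfold weilSemilocalPrimeTerm
  rw [tsum_eq_sum hvan]
  calc ‖∑ n ∈ s, (weilSemilocalCoeff S n : ℂ) * (k (Real.log n) + k (-Real.log n))‖
      ≤ ∑ n ∈ s, ‖(weilSemilocalCoeff S n : ℂ) * (k (Real.log n) + k (-Real.log n))‖ := norm_sum_le _ _
    _ ≤ ∑ n ∈ s, weilSemilocalCoeff S n * (2 * M) := by
        refine Finset.sum_le_sum fun n _ ↦ ?_
        rw [norm_mul, Complex.norm_real, Real.norm_eq_abs, abs_of_nonneg (weilSemilocalCoeff_nonneg S n)]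
        refine mul_le_mul_of_nonneg_left ?_ (weilSemilocalCoeff_nonneg S n)
        exact (norm_add_le _ _).trans (by linarith [hbound (Real.log n), hbound (-Real.log n)])
    _ = 2 * (∑ n ∈ Finset.Icc ⌈Real.exp (2 * c')⌉₊ ⌊Real.exp (2 * b)⌋₊, weilSemilocalCoeff S n) * M := by
        rw [← hs, ← Finset.sum_mul]; ring

/-! ## §2 The odd two-lobe energy in every `Q_S`: identity and witness-side bound -/

/-- **Energy of an antisymmetrised lobe in `Q_S`.** For a Weil test function `f` and every finite `S`:
`Q_S(f − f(−·)) = 2·Q_S(f) − 2·W_S(f ⋆ (f(−·))~)` (polarisation `weilSemilocalQuadratic_add`, `Q_S(−g) = Q_S(g) = Q_S(f)` for `g = f(−·)`,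
and the two cross energies coincide because `W_S` is reflection invariant). [this track, ATTEMPT-12 §2; cite: Bombieri2000Weil, §3 (hermitian form)] -/
theorem weilSemilocalQuadratic_sub_comp_neg (S : Finset ℕ) (hf : IsWeilTest f) :
    weilSemilocalQuadratic S (fun x ↦ f x - f (-x)) =
      2 * weilSemilocalQuadratic S f - 2 * weilSemilocalFunctional S (weilConv f (weilReflect fun x ↦ f (-x))) := by
  set g : ℝ → ℂ := fun x ↦ f (-x) with hg_def
  set hm : ℝ → ℂ := fun x ↦ (-1 : ℂ) * g x with hm_def
  have hg : IsWeilTest g := hf.comp_neg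
  have hhm : IsWeilTest hm := hg.const_mul (-1)
  have hsum : (fun x ↦ f x - f (-x)) = f + hm := by
    funext x
    simp only [hm_def, hg_def, Pi.add_apply]
    ring
  rw [hsum, weilSemilocalQuadratic_add S hf hhm]
  have hQ : weilSemilocalQuadratic S hm = weilSemilocalQuadratic S f := by
    rw [hm_def, weilSemilocalQuadratic_const_mul, hg_def, weilSemilocalQuadratic_comp_neg]
    simp [Complex.normSq_neg, Complex.normSq_one]
  have h1 : weilSemilocalFunctional S (weilConv f (weilReflect hm)) =
      -weilSemilocalFunctional S (weilConv f (weilReflect g)) := by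
    rw [hm_def, weilReflect_const_mul, weilConv_const_mul_right, weilSemilocalFunctional_const_mul]
    simp
  have hcross : weilSemilocalFunctional S (weilConv g (weilReflect f)) =
      weilSemilocalFunctional S (weilConv f (weilReflect g)) := by
    rw [hg_def, weilConv_weilReflect_comp_neg_eq, weilSemilocalFunctional_comp_neg]
  have h2 : weilSemilocalFunctional S (weilConv hm (weilReflect f)) =
      -weilSemilocalFunctional S (weilConv f (weilReflect g)) := by
    rw [hm_def, weilConv_const_mul_left, weilSemilocalFunctional_const_mul, hcross]
    simp
  rw [hQ, h1, h2]
  ring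

/-- **Upper bound (the witness side) in `Q_S`.** For a lobe `f ⊆ [c′, b]` (`0 < c′ ≤ b`) and every finite `S`:
`Re Q_S(f − f(−·)) ≤ 2·Re Q_S(f) − 2(|f̂(0)|² + |f̂(1)|²) + 2·(4(b − c′)M(c′) + 2·Σ_{e^{2c′}≤n≤e^{2b}} Λ_S(n)/√n)·‖f‖₂²`
(polar part of the cross energy `= |f̂(0)|² + |f̂(1)|²` exactly; the `S`-prime and archimedean parts of the cross energy bounded in norm).
[this track, ATTEMPT-12 §2; cite: Bombieri2000Weil, Thm 2 (prime and archimedean terms)] -/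
theorem re_weilSemilocalQuadratic_sub_comp_neg_le (S : Finset ℕ) (hf : IsWeilTest f) {c' b : ℝ} (hc' : 0 < c')
    (hcb : c' ≤ b) (hfs : tsupport f ⊆ Icc c' b) :
    (weilSemilocalQuadratic S (fun x ↦ f x - f (-x))).re ≤
      2 * (weilSemilocalQuadratic S f).re - 2 * (Complex.normSq (weilMellin f 0) + Complex.normSq (weilMellin f 1)) +
        2 * (4 * archGapBound c' * (b - c') + 2 * (∑ n ∈ Finset.Icc ⌈Real.exp (2 * c')⌉₊ ⌊Real.exp (2 * b)⌋₊, weilSemilocalCoeff S n)) *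
          ∫ u : ℝ, ‖f u‖ ^ 2 := by
  set G := ∑ n ∈ Finset.Icc ⌈Real.exp (2 * c')⌉₊ ⌊Real.exp (2 * b)⌋₊, weilSemilocalCoeff S n with hG_def
  set g : ℝ → ℂ := fun x ↦ f (-x) with hg_def
  have hg : IsWeilTest g := hf.comp_neg
  have hgs : tsupport g ⊆ Icc (-b) (-c') := by
    intro x hx
    have := tsupport_comp_subset_preimage_of_continuous f continuous_neg (by simpa [Function.comp_def] using hx)
    have hm := hfs this
    simp only [Set.mem_Icc] at hm
    exact ⟨by linarith [hm.2], by linarith [hm.1]⟩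
  set Nf := ∫ u : ℝ, ‖f u‖ ^ 2 with hN_def
  have hN : 0 ≤ Nf := integral_nonneg fun _ ↦ by positivity
  have hNg : ∫ u : ℝ, ‖g u‖ ^ 2 = Nf := integral_neg_eq_self (fun u : ℝ ↦ ‖f u‖ ^ 2) volume
  set k := weilConv f (weilReflect g) with hk_def
  have hP : (weilPolarTerm k).re = Complex.normSq (weilMellin f 0) + Complex.normSq (weilMellin f 1) := by
    rw [hk_def, hg_def, weilPolarTerm_cross_reflect hf, Complex.ofReal_re]
  have hPr : ‖weilSemilocalPrimeTerm S k‖ ≤ 2 * G * ((Nf + Nf) / 2) := by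
    have h' : ‖weilSemilocalPrimeTerm S k‖ ≤
        2 * G * (((∫ u : ℝ, ‖f u‖ ^ 2) + ∫ u : ℝ, ‖g u‖ ^ 2) / 2) :=
      norm_weilSemilocalPrimeTerm_le_of_support S (c' := c') (b := b) hc'
        (fun y hy ↦ weilConv_weilReflect_eq_zero_of_lt hfs hgs (by linarith [(abs_lt.1 hy).2]))
        (fun y hy ↦ by
          rcases lt_or_ge y 0 with h0 | h0
          · exact weilConv_weilReflect_eq_zero_of_lt hfs hgs (by rw [abs_of_neg h0] at hy; linarith)
          · exact weilConv_weilReflect_eq_zero_of_gt hfs hgs (by rw [abs_of_nonneg h0] at hy; linarith))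
        (norm_weilConv_weilReflect_le_half_add hf hg)
    rwa [hNg] at h'
  have hA : ‖weilArchTerm k‖ ≤ 2 * (b - c') * archGapBound c' * (Nf + Nf) := by
    have := norm_weilArchTerm_cross_le hf hg hc' hcb hfs hgs
    rwa [hNg] at this
  have hre_pr : (weilSemilocalPrimeTerm S k).re ≤ ‖weilSemilocalPrimeTerm S k‖ := Complex.re_le_norm _
  have hre_ar : -‖weilArchTerm k‖ ≤ (weilArchTerm k).re := (abs_le.1 (Complex.abs_re_le_norm _)).1
  have hW : (weilSemilocalFunctional S k).re =
      (weilPolarTerm k).re - (weilSemilocalPrimeTerm S k).re + (weilArchTerm k).re := by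
    simp [weilSemilocalFunctional]
  rw [weilSemilocalQuadratic_sub_comp_neg S hf]
  have e : (2 * weilSemilocalQuadratic S f - 2 * weilSemilocalFunctional S k).re =
      2 * (weilSemilocalQuadratic S f).re - 2 * (weilSemilocalFunctional S k).re := by
    simp [Complex.sub_re, Complex.mul_re]
  rw [e, hW, hP]
  have hM0 : 0 ≤ archGapBound c' := (archGapBound_pos hc').le
  have hG0 : 0 ≤ G := Finset.sum_nonneg fun n _ ↦ weilSemilocalCoeff_nonneg S n
  nlinarith [hPr, hA, hre_pr, hre_ar, hM0, hG0, hN]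

/-- The antisymmetrisation of a lobe `f ⊆ [c′, b]` with `0 ≤ c′ ≤ b` is supported in `[−b, b]`. [folklore] -/
theorem tsupport_sub_comp_neg_subset {c' b : ℝ} (hc' : 0 ≤ c') (hcb : c' ≤ b) (hfs : tsupport f ⊆ Icc c' b) :
    tsupport (fun x ↦ f x - f (-x)) ⊆ Icc (-b) b := by
  have hzero : ∀ y : ℝ, y ∉ Icc c' b → f y = 0 := fun y hy ↦ image_eq_zero_of_notMem_tsupport fun h ↦ hy (hfs h)
  refine closure_minimal (fun x hx ↦ ?_) isClosed_Icc
  by_contra hxI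
  rw [Set.mem_Icc, not_and_or, not_le, not_le] at hxI
  have h0 : f x - f (-x) = 0 := by
    rcases hxI with h | h
    · rw [hzero x (fun hm ↦ by linarith [hm.1]), hzero (-x) (fun hm ↦ by linarith [hm.2])]; simp
    · rw [hzero x (fun hm ↦ by linarith [hm.2]), hzero (-x) (fun hm ↦ by linarith [hm.1])]; simp
  exact (Function.mem_support.1 hx) h0

/-! ## §3 A narrow bump has the same energy in every `Q_S` -/

/-- No prime power is `≤ 1`, so the `S`-smoothness condition below `N = 1` is vacuous. [folklore] -/
theorem primeFactors_subset_of_le_one (S : Finset ℕ) : ∀ n ≤ 1, IsPrimePow n → n.primeFactors ⊆ S :=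
  fun _ hn hp ↦ absurd hn (not_le.2 hp.one_lt)

/-- **A bump of radius `≤ (log 2)/2` sees no prime**: for every finite `S`, every centre `c` and every Weil test function `h` with
`tsupport h ⊆ [c − (log 2)/2, c + (log 2)/2]`, `Q_S(h) = Q(h)` (translate to the origin, where both prime terms are empty). [folklore] -/
theorem weilSemilocalQuadratic_eq_weilQuadratic_of_narrow (S : Finset ℕ) (hh : IsWeilTest h) {c : ℝ}
    (hsupp : tsupport h ⊆ Icc (c - Real.log 2 / 2) (c + Real.log 2 / 2)) :
    weilSemilocalQuadratic S h = weilQuadratic h := by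
  set g : ℝ → ℂ := fun x ↦ h (x + c) with hg_def
  have hg : IsWeilTest g := isWeilTest_recentre hh c
  have hgs : tsupport g ⊆ Icc (-(Real.log 2 / 2)) (Real.log 2 / 2) := tsupport_recentre_subset hsupp
  have hback : (fun x ↦ g (x - c)) = h := by
    funext x
    simp [hg_def]
  have h2 : Real.log (((1 : ℕ) : ℝ) + 1) / 2 = Real.log 2 / 2 := by norm_num
  have hgs' : tsupport g ⊆ Icc (-(Real.log (((1 : ℕ) : ℝ) + 1) / 2)) (Real.log (((1 : ℕ) : ℝ) + 1) / 2) := by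
    rwa [h2]
  rw [← hback, weilSemilocalQuadratic_translate, weilQuadratic_translate,
    weilSemilocalQuadratic_eq_weilQuadratic_of_forall hg (primeFactors_subset_of_le_one S) hgs']

/-- **Energy ceiling of the Cramér bump in every `Q_S`.** For `0 < r ≤ 1/4`, any centre `x₀` and every finite `S`:
`Re Q_S(cramerBump r x₀) ≤ (log(1/r) + cramerEnergyConst)·∫‖cramerBump r x₀‖²` (gen2's `re_weilQuadratic_cramerBump_le`, the bump being
too narrow to see a prime). [this track, ATTEMPT-7 §5 / ATTEMPT-12 §2; cite: Bombieri2000Weil, §12 (12.3)–(12.5) for E(g)] -/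
theorem re_weilSemilocalQuadratic_cramerBump_le (S : Finset ℕ) {r : ℝ} (hr : 0 < r) (hr4 : r ≤ 1 / 4) (x₀ : ℝ) :
    (weilSemilocalQuadratic S (cramerBump r x₀)).re ≤
      (Real.log (1 / r) + cramerEnergyConst) * ∫ x : ℝ, ‖cramerBump r x₀ x‖ ^ 2 := by
  have hl2 := Real.log_two_gt_d9
  have hsupp : tsupport (cramerBump r x₀) ⊆ Icc (x₀ - Real.log 2 / 2) (x₀ + Real.log 2 / 2) :=
    (tsupport_cramerBump_subset hr x₀).trans (Icc_subset_Icc (by linarith) (by linarith))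
  rw [weilSemilocalQuadratic_eq_weilQuadratic_of_narrow S (isWeilTest_cramerBump hr x₀) hsupp]
  exact re_weilQuadratic_cramerBump_le hr hr4 x₀

/-! ## §4 Past the top of `S` only higher prime powers are `S`-smooth -/

/-- For `S ⊆ [0, N)` and `n ≥ N`: `Λ_S(n)/√n ≤ [n not prime]·Λ(n)/√N` (an `S`-smooth prime `n` would lie in `S`, hence below `N`). [folklore] -/
theorem weilSemilocalCoeff_le_of_forall_lt (hS : ∀ p ∈ S, p < N) (hN : 0 < N) {n : ℕ} (hn : N ≤ n) :
    weilSemilocalCoeff S n ≤ (if ¬ n.Prime then (Λ n : ℝ) else 0) / Real.sqrt N := by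
  have hN0 : (0 : ℝ) < N := by exact_mod_cast hN
  have hsN : 0 < Real.sqrt N := Real.sqrt_pos.2 hN0
  unfold weilSemilocalCoeff
  by_cases hp : n.Prime
  · have hns : ¬ n.primeFactors ⊆ S := fun hsub ↦ by
      have hmem : n ∈ S := hsub (by rw [Nat.Prime.primeFactors hp]; exact Finset.mem_singleton_self n)
      exact absurd (hS n hmem) (not_lt.2 hn)
    rw [if_neg hns, if_neg (not_not.2 hp), zero_div]
  · rw [if_pos hp]
    by_cases hsub : n.primeFactors ⊆ S
    · rw [if_pos hsub]
      exact div_le_div_of_nonneg_left ArithmeticFunction.vonMangoldt_nonneg hsN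
        (Real.sqrt_le_sqrt (show (N : ℝ) ≤ (n : ℝ) by exact_mod_cast hn))
    · rw [if_neg hsub]
      exact div_nonneg ArithmeticFunction.vonMangoldt_nonneg hsN.le

/-- **The `S`-smooth atoms above the top of `S` are higher prime powers**: for `S ⊆ [0, N)`, `N ≥ 1` and `e^{2b} ≤ X`,
`Σ_{e^{log N} ≤ n ≤ e^{2b}} Λ_S(n)/√n ≤ (ψ(X) − θ(X))/√N` (Mathlib's `Chebyshev.psi_sub_theta_eq_sum_not_prime`). [folklore] -/
theorem sum_weilSemilocalCoeff_le_psi_sub_theta (hS : ∀ p ∈ S, p < N) (hN : 0 < N) {b X : ℝ}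
    (hbX : Real.exp (2 * b) ≤ X) :
    (∑ n ∈ Finset.Icc ⌈Real.exp (2 * (Real.log N / 2))⌉₊ ⌊Real.exp (2 * b)⌋₊, weilSemilocalCoeff S n) ≤
      (Chebyshev.psi X - Chebyshev.theta X) / Real.sqrt N := by
  have hN0 : (0 : ℝ) < N := by exact_mod_cast hN
  have hexp : Real.exp (2 * (Real.log N / 2)) = N := by
    rw [show 2 * (Real.log N / 2) = Real.log N by ring, Real.exp_log hN0]
  rw [hexp, Nat.ceil_natCast, Chebyshev.psi_sub_theta_eq_sum_not_prime, Finset.sum_filter]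
  have hsub : Finset.Icc N ⌊Real.exp (2 * b)⌋₊ ⊆ Finset.Ioc 0 ⌊X⌋₊ := by
    intro n hn
    rw [Finset.mem_Icc] at hn
    rw [Finset.mem_Ioc]
    exact ⟨by omega, hn.2.trans (Nat.floor_le_floor hbX)⟩
  calc ∑ n ∈ Finset.Icc N ⌊Real.exp (2 * b)⌋₊, weilSemilocalCoeff S n
      ≤ ∑ n ∈ Finset.Icc N ⌊Real.exp (2 * b)⌋₊, (if ¬ n.Prime then (Λ n : ℝ) else 0) / Real.sqrt N :=
        Finset.sum_le_sum fun n hn ↦ weilSemilocalCoeff_le_of_forall_lt hS hN (Finset.mem_Icc.1 hn).1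
    _ = (∑ n ∈ Finset.Icc N ⌊Real.exp (2 * b)⌋₊, (if ¬ n.Prime then (Λ n : ℝ) else 0)) / Real.sqrt N := by
        rw [Finset.sum_div]
    _ ≤ (∑ n ∈ Finset.Ioc 0 ⌊X⌋₊, (if ¬ n.Prime then (Λ n : ℝ) else 0)) / Real.sqrt N := by
        refine div_le_div_of_nonneg_right (Finset.sum_le_sum_of_subset_of_nonneg hsub fun n _ _ ↦ ?_)
          (Real.sqrt_nonneg _)
        split_ifs
        · exact le_rfl
        · exact ArithmeticFunction.vonMangoldt_nonneg

/-- `ψ(X) − θ(X) ≤ 3·√N` for `N ≥ 10⁷` and `N ≤ X ≤ 2N` (Mathlib's `ψ − θ ≤ ψ(√X) + 2ψ(X^{1/3})` and gen2's explicit Chebyshev bounds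
`ψ(y) ≤ 1.681y` (`y ≥ e⁸`), `ψ(z) ≤ 2.49z` (`z ≥ e⁴`)). [folklore] -/
theorem psi_sub_theta_le_three_mul_sqrt {X : ℝ} (hN7 : (10 : ℝ) ^ 7 ≤ N) (hNX : (N : ℝ) ≤ X) (hX : X ≤ 2 * N) :
    Chebyshev.psi X - Chebyshev.theta X ≤ 3 * Real.sqrt N := by
  have hN0 : (0 : ℝ) < N := lt_of_lt_of_le (by norm_num) hN7
  have hX0 : 0 < X := hN0.trans_le hNX
  have h16 : Real.exp 16 ≤ N := exp_sixteen_le.trans hN7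
  have h16' : Real.exp 16 ≤ X := h16.trans hNX
  have hX1 : (1 : ℝ) ≤ X := (Real.one_le_exp (by norm_num : (0:ℝ) ≤ 16)).trans h16'
  have hsqrt : Real.exp 8 ≤ Real.sqrt X := by
    have e2 : Real.sqrt (Real.exp 16) = Real.exp 8 := by
      rw [show (16 : ℝ) = 8 + 8 by norm_num, Real.exp_add, Real.sqrt_mul_self (Real.exp_pos 8).le]
    rw [← e2]
    exact Real.sqrt_le_sqrt h16'
  have hcbrt : Real.exp 4 ≤ X ^ ((3 : ℝ)⁻¹) := by
    have h12 : Real.exp 12 ≤ X := (Real.exp_le_exp.2 (by norm_num : (12:ℝ) ≤ 16)).trans h16'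
    have e : Real.exp 12 ^ ((3 : ℝ)⁻¹) = Real.exp 4 := by
      rw [← Real.exp_mul]; norm_num
    rw [← e]
    exact Real.rpow_le_rpow (Real.exp_pos 12).le h12 (by norm_num)
  have h2 := psi_sub_theta_le_sqrt_add_two_cbrt hX1
  have h3 := psi_le_of_exp_eight_le hsqrt
  have h4 := psi_le_of_exp_four_le hcbrt
  have hs : Real.sqrt X ≤ 1.4143 * Real.sqrt N := by
    have hb : X ≤ (1.4143 * Real.sqrt N) ^ 2 := by
      have := Real.sq_sqrt hN0.le
      nlinarith [this]
    exact Real.sqrt_le_iff.2 ⟨by positivity, hb⟩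
  have hsplit : X ^ ((3 : ℝ)⁻¹) = Real.sqrt X * X ^ (-(6 : ℝ)⁻¹) := by
    rw [Real.sqrt_eq_rpow, ← Real.rpow_add hX0]
    norm_num
  have hsmall : X ^ (-(6 : ℝ)⁻¹) ≤ 0.0834 := by
    have ha : X ^ (-(6 : ℝ)⁻¹) ≤ Real.exp 16 ^ (-(6 : ℝ)⁻¹) :=
      Real.rpow_le_rpow_of_nonpos (Real.exp_pos 16) h16' (by norm_num)
    have hb : Real.exp 16 ^ (-(6 : ℝ)⁻¹) = Real.exp (-(8 / 3)) := by
      rw [← Real.exp_mul]; norm_num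
    have hc : Real.exp (-(8 / 3 : ℝ)) ≤ Real.exp (-(5 / 2)) := Real.exp_le_exp.2 (by norm_num)
    have hd : Real.exp (-(5 / 2 : ℝ)) ≤ 0.0834 := by
      rw [Real.exp_neg, inv_le_comm₀ (Real.exp_pos _) (by norm_num)]
      linarith [exp_five_half_ge]
    linarith [ha, hb.le, hb.ge, hc, hd]
  have hcb : X ^ ((3 : ℝ)⁻¹) ≤ 0.0834 * Real.sqrt X := by
    rw [hsplit, mul_comm (0.0834 : ℝ)]
    exact mul_le_mul_of_nonneg_left hsmall (Real.sqrt_nonneg _)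
  have hsq0 : 0 ≤ Real.sqrt N := Real.sqrt_nonneg _
  have hsq'0 : 0 ≤ Real.sqrt X := Real.sqrt_nonneg _
  nlinarith [h2, h3, h4, hs, hcb, hsq0, hsq'0]

/-- **The `S`-smooth atoms of the virtual gap are cheap**: for `S ⊆ [0, N)`, `N ≥ 10⁷` and `N ≤ e^{2b} ≤ 2N`,
`Σ_{e^{log N} ≤ n ≤ e^{2b}} Λ_S(n)/√n ≤ 3`. [this track, ATTEMPT-12 §2] -/
theorem sum_weilSemilocalCoeff_le_three (hS : ∀ p ∈ S, p < N) (hN7 : (10 : ℝ) ^ 7 ≤ N) {b : ℝ}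
    (hNb : (N : ℝ) ≤ Real.exp (2 * b)) (hb : Real.exp (2 * b) ≤ 2 * N) :
    (∑ n ∈ Finset.Icc ⌈Real.exp (2 * (Real.log N / 2))⌉₊ ⌊Real.exp (2 * b)⌋₊, weilSemilocalCoeff S n) ≤ 3 := by
  have hN0 : (0 : ℝ) < N := lt_of_lt_of_le (by norm_num) hN7
  have hN : 0 < N := by exact_mod_cast hN0
  have hsq : 0 < Real.sqrt N := Real.sqrt_pos.2 hN0
  have h1 := sum_weilSemilocalCoeff_le_psi_sub_theta hS hN (le_refl (Real.exp (2 * b)))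
  have h2 := psi_sub_theta_le_three_mul_sqrt hN7 hNb hb
  have h3 : (Chebyshev.psi (Real.exp (2 * b)) - Chebyshev.theta (Real.exp (2 * b))) / Real.sqrt N ≤ 3 := by
    rw [div_le_iff₀ hsq]; linarith
  exact h1.trans h3

end Summit.RiemannHypothesis.RiemannHypothesis.Theorems.Handoff
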